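import Summits.QuantumFields.YangMills.Theorems.LuscherReductionOneSiteLevelsQuatPullback
import Literature.Analysis.OperatorTheory.YangMillsMatrixModelDiscreteSpectrum

/-!
# `SO(3)` glue: colour-rotation invariance on `ℝ⁹` (`IsGaugeInv`) ⟹ invariance under the quaternion rotations `ρ(g)`, and the
# physical pull-back of `IsGaugeInv` functions (support module for `stub_absLower` / `stub_absUpperInner` of crux `OneSiteLevels`,
# route `LuscherReduction`, item stmt-QuantumFields-20007; fleet lead prover ym-luscher-20007-p1)

`Theorems/LuscherReductionOneSiteLevelsQuatPullback.lean` proves that `U ↦ F((foldVec U_e)_e)` is physical whenever `F` is invariant under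
the simultaneous rotations `ρ(g) = qrotFun (su2Quat g)`.  The quasimodes of the `ℝ⁹` side (`LuscherHamiltonianEigenfunctions.quasimodes`,
lit g6) are `IsGaugeInv` in the sense of `YangMillsMatrixModelDiscreteSpectrum`: invariant under `colourRotate R`, `R ∈ SO(3)` a MATRIX.
This module closes the gap: the matrix `rotMat q` of `ρ(q)` in the standard orthonormal basis lies in `Matrix.specialOrthogonalGroup (Fin 3) ℝ`
(`rotMat_mem_specialOrthogonalGroup`: orthogonal as the matrix of a linear isometry, `det = 1` by the tree's `det_qrot`), and
`colourRotate (rotMat q)` IS the simultaneous action of `ρ(q)` on the three colour vectors (`colourRotate_rotMat`).  Hence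
(`apply_qrot_eq_of_isGaugeInv`) an `IsGaugeInv` function takes the same value on `ρ(g)`-rotated triples, and (`isPhys_pullback_of_isGaugeInv`)
for every bounded measurable `IsGaugeInv F : ZM → ℝ` and every scale `c`, the one-site test function
`U ↦ F(c · foldVec(U_1), c · foldVec(U_2), c · foldVec(U_3))` is PHYSICAL — the lattice-side door for the quasimode floors (AL2) and for
the constraint functions of the inner comparison.

## WHAT THIS IS NOT
No analysis; NOT the crux, NOT THE CLAY GAP.  Sorry-free; no named fact.
-/

set_option autoImplicit false

noncomputable section

open MeasureTheory Filter Topology Real Quaternion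
open scoped Matrix ComplexConjugate BigOperators Quaternion
open Literature.MathematicalPhysics.QuantumFieldTheory
open Literature.MathematicalPhysics.QuantumLattice
open Literature.Analysis.FluidPDE.Tao2016
open Literature.Analysis.OperatorTheory.YMMatrixModel

namespace Summit.QuantumFields.YangMills.Theorems.FemtoTransferGap

/-! ### §1. The rotation matrix of a quaternion -/

/-- The standard orthonormal basis of `ℝ³`, as a `Basis`. -/
abbrev stdBasis3 : Module.Basis (Fin 3) ℝ (EuclideanSpace ℝ (Fin 3)) := (EuclideanSpace.basisFun (Fin 3) ℝ).toBasis

/-- **The rotation matrix `rotMat q ∈ M₃(ℝ)` of the quaternion rotation `ρ(q) = qrot q`** in the standard orthonormal basis. [folklore] -/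
def rotMat (q : ℍ) : Matrix (Fin 3) (Fin 3) ℝ :=
  LinearMap.toMatrix stdBasis3 stdBasis3 ((qrot q).toLinearEquiv : EuclideanSpace ℝ (Fin 3) →ₗ[ℝ] EuclideanSpace ℝ (Fin 3))

/-- `rotMat q` is orthogonal (matrix of a linear isometry in an orthonormal basis). [folklore] -/
theorem rotMat_mem_orthogonalGroup (q : ℍ) : rotMat q ∈ Matrix.orthogonalGroup (Fin 3) ℝ :=
  LinearIsometryEquiv.toMatrix_mem_unitaryGroup (qrot q) (EuclideanSpace.basisFun (Fin 3) ℝ) (EuclideanSpace.basisFun (Fin 3) ℝ)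

/-- `det (rotMat q) = 1` (tree `det_qrot`). [folklore] -/
theorem det_rotMat (q : ℍ) : (rotMat q).det = 1 := by
  rw [rotMat, LinearMap.det_toMatrix, det_qrot]

/-- **`rotMat q ∈ SO(3)`.** [folklore] -/
theorem rotMat_mem_specialOrthogonalGroup (q : ℍ) : rotMat q ∈ Matrix.specialOrthogonalGroup (Fin 3) ℝ :=
  Matrix.mem_specialOrthogonalGroup_iff.mpr ⟨rotMat_mem_orthogonalGroup q, det_rotMat q⟩

/-- `rotMat q` acts on coordinate vectors as `ρ(q)`: `Σ_b (rotMat q) a b · v b = (qrot q v) a`. [folklore] -/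
theorem rotMat_mulVec_apply (q : ℍ) (v : EuclideanSpace ℝ (Fin 3)) (a : Fin 3) :
    ∑ b, rotMat q a b * v b = (qrot q v) a := by
  have h := LinearMap.toMatrix_mulVec_repr stdBasis3 stdBasis3
    ((qrot q).toLinearEquiv : EuclideanSpace ℝ (Fin 3) →ₗ[ℝ] EuclideanSpace ℝ (Fin 3)) v
  have hv : ∀ (w : EuclideanSpace ℝ (Fin 3)) (i : Fin 3), (stdBasis3.repr w) i = w i := fun w i => rfl
  have := congr_fun h a
  simp only [Matrix.mulVec, dotProduct, hv] at this
  rw [← rotMat] at this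
  exact this

/-! ### §2. `colourRotate (rotMat q)` is the simultaneous action of `ρ(q)` -/

/-- The `i`-th colour vector of a zero-mode configuration, as an element of `ℝ³`. -/
abbrev colourVec3 (x : ZM) (i : Fin 3) : EuclideanSpace ℝ (Fin 3) := WithLp.toLp 2 fun a => x (i, a)

/-- `colourRotate (rotMat q) x` rotates every colour vector by `ρ(q)`. [folklore] -/
theorem colourRotate_rotMat (q : ℍ) (x : ZM) (p : Fin 3 × Fin 3) :
    colourRotate (rotMat q) x p = (qrot q (colourVec3 x p.1)) p.2 := by
  rw [← rotMat_mulVec_apply]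
  simp [colourRotate]

/-- **An `IsGaugeInv` function is invariant under the simultaneous quaternion rotations `ρ(g)`** of the three colour vectors
(`g ∈ SU(2)`; `su2Quat g ≠ 0`). [cite: Vanbaal2001, §4] -/
theorem apply_qrot_eq_of_isGaugeInv {F : ZM → ℝ} (hF : IsGaugeInv F) (g : SU2) (v : Fin 3 → EuclideanSpace ℝ (Fin 3)) :
    F (WithLp.toLp 2 fun p : Fin 3 × Fin 3 => (qrotFun (su2Quat g) (v p.1)) p.2)
      = F (WithLp.toLp 2 fun p : Fin 3 × Fin 3 => (v p.1) p.2) := by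
  set x : ZM := WithLp.toLp 2 fun p : Fin 3 × Fin 3 => (v p.1) p.2 with hx
  have h := hF (rotMat (su2Quat g)) (rotMat_mem_specialOrthogonalGroup _) x
  rw [← h]
  congr 1
  ext p
  rw [colourRotate_rotMat, qrot_apply (su2Quat_ne_zero g)]

/-! ### §3. The physical pull-back of an `IsGaugeInv` function -/

/-- **Physical pull-back of a colour-rotation-invariant function.**  For every bounded measurable `IsGaugeInv F : ZM → ℝ` and every
scale `c` (intended `c = 2/λ_b`), the one-site test function `U ↦ F(c·foldVec(U_1), c·foldVec(U_2), c·foldVec(U_3))` is PHYSICAL.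
[cite: Luscher1983, §2] [cite: Vanbaal2001, §4] -/
theorem isPhys_pullback_of_isGaugeInv (F : ZM → ℝ) (hF : IsGaugeInv F) (hFm : Measurable F) {C : ℝ} (hC : ∀ x, |F x| ≤ C) (c : ℝ) :
    IsPhys (fun U : GaugeConfig 3 1 SU2 =>
      F (WithLp.toLp 2 fun p : Fin 3 × Fin 3 => c * foldVec (U ((default : Site 3 1), p.1)) p.2)) := by
  -- package as a function of the edge-indexed folded vector parts
  set F' : (Edge 3 1 → Fin 3 → ℝ) → ℝ := fun w => F (WithLp.toLp 2 fun p : Fin 3 × Fin 3 => c * w (default, p.1) p.2) with hF'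
  have hmeas : Measurable F' := by
    refine hFm.comp ?_
    refine (PiLp.continuous_toLp 2 _).measurable.comp ?_
    exact measurable_pi_lambda _ fun p => measurable_const.mul ((measurable_pi_apply p.2).comp (measurable_pi_apply _))
  have hbd : ∀ w, |F' w| ≤ C := fun w => hC _
  have hrot : ∀ (g : SU2) (v : Edge 3 1 → EuclideanSpace ℝ (Fin 3)),
      F' (fun e a => qrotFun (su2Quat g) (v e) a) = F' (fun e a => v e a) := by
    intro g v
    simp only [hF']
    have h := apply_qrot_eq_of_isGaugeInv hF g (fun i => c • v (default, i))
    have e1 : (WithLp.toLp 2 fun p : Fin 3 × Fin 3 => c * qrotFun (su2Quat g) (v (default, p.1)) p.2)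
        = WithLp.toLp 2 fun p : Fin 3 × Fin 3 => (qrotFun (su2Quat g) (c • v (default, p.1))) p.2 := by
      congr 1; funext p; rw [qrotFun_smul]; rfl
    have e2 : (WithLp.toLp 2 fun p : Fin 3 × Fin 3 => c * v (default, p.1) p.2)
        = WithLp.toLp 2 fun p : Fin 3 × Fin 3 => (c • v (default, p.1)) p.2 := by
      congr 1
    rw [e1, e2, h]
  have key := isPhys_foldVecFun F' hmeas hbd hrot
  simpa [hF'] using key

end Summit.QuantumFields.YangMills.Theorems.FemtoTransferGap

end
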